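import Literature.AnabelianGeometry.AbsoluteAnabelian.AbsTopIThm26vFullResidual
import Literature.AnabelianGeometry.AbsoluteAnabelian.InvariantCharacterTransferProofs
import HarnessLib

/-!
# [AbsTopI] Thm 2.6 (iii), clause two: the reduction to a RANK EXCESS at an open subgroup (prep)

S. Mochizuki, *Topics in Absolute Anabelian Geometry I: Generalities* (2012) [AbsTopI], proof of
Thm 2.6 (iii), p. 23 l. 36–41: "If the cardinality of `θ¹(Π)` is `≥ 2`, then there exists some open
subgroup `H ⊆ Π` and some `l ∈ Primes` such that `δ¹_l(H) ≥ 2`, `l ≠ p`. [...] Then [since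
`δ¹_l(G) = 1`, by assertion (ii)] the fact that `δ¹_l(Π) ≥ 2` implies that `l ∈ Σ`, and
`dim_{ℚ_l}(R_l ⊗ ℚ_l) ≥ 1`".

PROOF-ONLY prep file (no definitions, no named facts) for the abc-iut row «THM26-PRIMES-COROLLARIES»
(L4-lead RULING #8i): everything in that printed passage EXCEPT the Lemma 2.7 (iii) injection, for an
arbitrary extension `1 → Δ → Π → G → 1` with MLF base data and `Δ` pro-`Σ`, at EVERY open `H ⊆ Π`:

* `thetaSet_mono_of_isOpen` — `θʲ(J) ⊆ θʲ(H)` for open subgroups `J ≤ H` of a topological group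
  (`εʲ_l` is a supremum over open subgroups);
* `MLFBase.freeProlRank_eq_map_aug_of_not_mem` — off `Σ` there is NO rank excess at any open `J`:
  `δ¹_l(J) = δ¹_l(G_J)` for `l ∉ Σ` (`Δ ∩ J` pro-`Σ`, `IsProSet.apply_padicIntPi_eq_one`,
  `exists_continuousMonoidHom_factor`);
* `MLFBase.exists_open_rankExcess_of_two_le_encard` — if `|θ¹(H)| ≥ 2` then some open `J ≤ H` and
  some prime `l ∈ Σ`, `l ≠ p`, have `δ¹_l(J) ≥ 2` while `δ¹_l(G_J) = 1` (LCFT,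
  `freeProlRank_map_aug_of_rank`): a RANK EXCESS `≥ 1` at `l ∈ Σ` — the input of Lemma 2.7 (iii)
  ("`dim(R_l ⊗ ℚ_l) ≥ 1`").

So the remaining content of clause two is exactly: «rank excess `≥ 1` at some `l₀ ∈ Σ` on an open
`J ≤ H` ⇒ `Σ ⊆ θ²(J)`» (Lemma 2.7 (ii) rank-independence + (iii) injections), to be supplied by the
cell's typing of Lemma 2.7 (rows «LEM27iii-TYPE» / `Thm26iii′`).  HONEST FRAMING: refereed,
undisputed; abc-iut seat abc-iut-w6-d034; nothing here bears on [IUTchIII] Cor. 3.12.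
-/

noncomputable section

open Topology

namespace Literature.AnabelianGeometry.AbsoluteAnabelian

universe u

/-! ### `θʲ` is monotone along open subgroups -/

section Mono

variable {Λ : Type u} [Group Λ] [TopologicalSpace Λ] [IsTopologicalGroup Λ]

/-- For open subgroups `J ≤ H` of a topological group, `θʲ(J) ⊆ θʲ(H)`: an open subgroup of `J` is
(isomorphic to) an open subgroup of `H`, so `εʲ_l(J) ≤ εʲ_l(H)`.
[cite: MochizukiAbsTopI2012, Thm 2.6 p.21] -/
theorem thetaSet_mono_of_isOpen {J H : Subgroup Λ} (hJ : IsOpen (J : Set Λ)) (hJH : J ≤ H)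
    (j : ℕ) : thetaSet J j ⊆ thetaSet H j := by
  intro l hl
  obtain ⟨hlp, hle⟩ := hl
  refine ⟨hlp, hle.trans ?_⟩
  haveI : Fact l.Prime := ⟨hlp⟩
  unfold epsilonInv
  refine iSup₂_le fun J' hJ' => ?_
  -- `J'` pushed into `H`
  let ι : J →* H := Subgroup.inclusion hJH
  have hιc : Continuous ι := Continuous.subtype_mk continuous_subtype_val _
  have hιo : IsOpenMap ι := by
    intro U hU
    have hU' : IsOpen (Subtype.val '' U : Set Λ) := hJ.isOpenMap_subtype_val U hU
    have : (ι '' U : Set H) = Subtype.val ⁻¹' (Subtype.val '' U : Set Λ) := by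
      ext y
      constructor
      · rintro ⟨x, hx, rfl⟩
        exact ⟨x, hx, rfl⟩
      · rintro ⟨x, hx, hxy⟩
        refine ⟨x, hx, Subtype.ext hxy⟩
    rw [this]
    exact hU'.preimage continuous_subtype_val
  have hJ'o : IsOpen ((J'.map ι : Subgroup H) : Set H) := by
    rw [Subgroup.coe_map]
    exact hιo _ hJ'
  have hmemJ : ∀ y : (J'.map ι : Subgroup H), ((y : H) : Λ) ∈ J := fun y => by
    obtain ⟨x, -, hxy⟩ := y.2
    rw [← hxy]
    exact x.2
  have hmemJ' : ∀ y : (J'.map ι : Subgroup H), (⟨((y : H) : Λ), hmemJ y⟩ : J) ∈ J' := fun y => by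
    obtain ⟨x, hx, hxy⟩ := y.2
    have hx' : (⟨((y : H) : Λ), hmemJ y⟩ : J) = x := by
      apply Subtype.ext
      change ((y : H) : Λ) = (x : Λ)
      rw [← hxy]
      rfl
    rw [hx']
    exact hx
  let e : J' ≃ₜ* (J'.map ι : Subgroup H) :=
    { toFun := fun x => ⟨ι x, ⟨x, x.2, rfl⟩⟩
      invFun := fun y => ⟨⟨((y : H) : Λ), hmemJ y⟩, hmemJ' y⟩
      left_inv := fun _ => rfl
      right_inv := fun _ => rfl
      map_mul' := fun _ _ => Subtype.ext (map_mul ι _ _)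
      continuous_toFun := (hιc.comp continuous_subtype_val).subtype_mk _
      continuous_invFun :=
        ((continuous_subtype_val.comp continuous_subtype_val).subtype_mk _).subtype_mk _ }
  rw [deltaInv_eq_of_continuousMulEquiv e j l]
  exact le_iSup₂_of_le (J'.map ι) hJ'o le_rfl

end Mono

namespace FundamentalExtension

variable {E : FundamentalExtension.{0}}

/-- **No rank excess off `Σ`, at every open subgroup**: for `Δ` pro-`Σ`, an open `J ⊆ Π` and a prime
`l ∉ Σ`, `δ¹_l(J) = δ¹_l(G_J)` (`G_J = aug(J)`): a continuous `J ↠ ℤ_lⁿ` kills the pro-`Σ` group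
`Δ ∩ J` and factors through `J ↠ G_J` ("`δ¹_l(Π) = δ¹_l(G)` for `l ∉ Σ`", proof of (ii) p. 23, at
the open subgroup). [cite: MochizukiAbsTopI2012, Thm 2.6 (ii) proof p.23] -/
theorem freeProlRank_eq_map_aug_of_not_mem {S : Set ℕ} (hΔS : IsProSet E.geom S)
    (J : Subgroup E.arith) (hJ : IsOpen (J : Set E.arith)) {l : ℕ} [Fact l.Prime] (hlS : l ∉ S) :
    freeProlRank J l = freeProlRank (J.map E.aug.toMonoidHom) l := by
  have hJc : IsClosed (J : Set E.arith) := J.isClosed_of_isOpen hJ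
  haveI : CompactSpace J := isCompact_iff_compactSpace.mp hJc.isCompact
  let a : J →ₜ* (J.map E.aug.toMonoidHom) :=
    ⟨E.aug.toMonoidHom.subgroupMap J,
      Continuous.subtype_mk ((map_continuous E.aug).comp continuous_subtype_val) _⟩
  have ha : Function.Surjective a := E.aug.toMonoidHom.subgroupMap_surjective J
  refine le_antisymm ?_ (freeProlRank_le_of_surjective a ha l)
  unfold freeProlRank
  refine iSup₂_le fun n hn => ?_
  obtain ⟨f, hf⟩ := hn
  have hpro : IsProSet ↥(E.geom ⊓ J) S := E.isProSet_geom_inf_of_isOpen hΔS J hJ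
  -- `f` kills `Δ ∩ J`
  have hker : ∀ x : J, a x = 1 → f x = 1 := by
    intro x hx
    have hxΔ : (x : E.arith) ∈ E.geom := by
      rw [mem_geom]
      exact congrArg Subtype.val hx
    let ψ : ↥(E.geom ⊓ J) →ₜ* Multiplicative (Fin n → ℤ_[l]) :=
      ⟨f.toMonoidHom.comp
        { toFun := fun y => ⟨y.1, y.2.2⟩
          map_one' := rfl
          map_mul' := fun _ _ => rfl },
        f.continuous.comp (Continuous.subtype_mk continuous_subtype_val _)⟩
    exact hpro.apply_padicIntPi_eq_one hlS ψ ⟨x, hxΔ, x.2⟩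
  obtain ⟨χ, hχ⟩ := exists_continuousMonoidHom_factor a ha f hker
  have hχs : Function.Surjective χ := fun y => by
    obtain ⟨x, hx⟩ := hf y
    exact ⟨a x, by rw [hχ, hx]⟩
  exact le_iSup₂_of_le n ⟨χ, hχs⟩ le_rfl

/-- **The rank-excess reduction of [AbsTopI] Thm 2.6 (iii), clause two** (proof p. 23 l. 36–41), at
every open `H ⊆ Π` of an extension with MLF base data and `Δ` pro-`Σ` (`Σ ⊆ Primes`): if
`|θ¹(H)| ≥ 2`, then for some open `J ≤ H` (open in `Π`) and some prime `l ∈ Σ` with `l ≠ p`,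
`δ¹_l(J) ≥ 2` while `δ¹_l(G_J) = 1` — a rank excess `≥ 1` at a prime of `Σ`
("`dim_{ℚ_l}(R_l ⊗ ℚ_l) ≥ 1`"). [cite: MochizukiAbsTopI2012, Thm 2.6 (iii) proof p.23] -/
theorem MLFBase.exists_open_rankExcess_of_two_le_encard (B : E.MLFBase) {S : Set ℕ}
    (hΔS : IsProSet E.geom S) (H : Subgroup E.arith) (hH : IsOpen (H : Set E.arith))
    (h2 : 2 ≤ (thetaSet H 1).encard) :
    ∃ (J : Subgroup E.arith), IsOpen (J : Set E.arith) ∧ J ≤ H ∧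
      ∃ (l : ℕ) (_ : Fact l.Prime), l ∈ S ∧ l ≠ B.p ∧ (2 : ℕ∞) ≤ freeProlRank J l ∧
        freeProlRank (J.map E.aug.toMonoidHom) l = 1 := by
  letI := B.instPrime
  have hHc : IsClosed (H : Set E.arith) := H.isClosed_of_isOpen hH
  haveI : CompactSpace H := isCompact_iff_compactSpace.mp hHc.isCompact
  -- a prime `l ≠ p` in `θ¹(H)`
  obtain ⟨l, hlθ, hlp⟩ : ∃ l ∈ thetaSet H 1, l ≠ B.p := by
    have h1 : 1 < (thetaSet H 1).encard := lt_of_lt_of_le (by norm_num) h2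
    obtain ⟨a, b, ha, hb, hab⟩ := Set.one_lt_encard_iff.mp h1
    by_cases hap : a = B.p
    · exact ⟨b, hb, fun hbp => hab (hap.trans hbp.symm)⟩
    · exact ⟨a, ha, hap⟩
  obtain ⟨hlP, hε⟩ := hlθ
  haveI : Fact l.Prime := ⟨hlP⟩
  -- an open `J₀ ≤ H` with `δ¹_l(J₀) ≥ 2`
  obtain ⟨J₀, hJ₀, hJ₀2⟩ : ∃ J₀ : Subgroup H, IsOpen (J₀ : Set H) ∧ (2 : ℕ∞) ≤ deltaInv J₀ 1 l := by
    by_contra hcon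
    push Not at hcon
    have hle : epsilonInv H 1 l ≤ 1 := by
      unfold epsilonInv
      refine iSup₂_le fun J₀ hJ₀ => ?_
      exact Order.le_of_lt_add_one (by rw [one_add_one_eq_two]; exact hcon J₀ hJ₀)
    have h2' : ((3 - 1 : ℕ) : ℕ∞) ≤ 1 := hε.trans hle
    norm_num at h2'
  -- push `J₀` into `Π`
  have hJo : IsOpen ((J₀.map H.subtype : Subgroup E.arith) : Set E.arith) := by
    have h1 : ((J₀.map H.subtype : Subgroup E.arith) : Set E.arith) = Subtype.val '' (J₀ : Set H) := by
      rw [Subgroup.coe_map]; rfl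
    rw [h1]
    exact hH.isOpenMap_subtype_val _ hJ₀
  have hmemH : ∀ y : (J₀.map H.subtype : Subgroup E.arith), (y : E.arith) ∈ H := fun y => by
    obtain ⟨x, -, hxy⟩ := y.2
    rw [← hxy]
    exact x.2
  have hmemJ : ∀ y : (J₀.map H.subtype : Subgroup E.arith), (⟨(y : E.arith), hmemH y⟩ : H) ∈ J₀ :=
    fun y => by
    obtain ⟨x, hx, hxy⟩ := y.2
    have hx' : (⟨(y : E.arith), hmemH y⟩ : H) = x := Subtype.ext hxy.symm
    rw [hx']
    exact hx
  let e : J₀ ≃ₜ* (J₀.map H.subtype : Subgroup E.arith) :=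
    { toFun := fun x => ⟨(x : H), ⟨x, x.2, rfl⟩⟩
      invFun := fun y => ⟨⟨(y : E.arith), hmemH y⟩, hmemJ y⟩
      left_inv := fun _ => rfl
      right_inv := fun _ => rfl
      map_mul' := fun _ _ => rfl
      continuous_toFun := (continuous_subtype_val.comp continuous_subtype_val).subtype_mk _
      continuous_invFun := (continuous_subtype_val.subtype_mk _).subtype_mk _ }
  haveI : CompactSpace J₀ :=
    isCompact_iff_compactSpace.mp (J₀.isClosed_of_isOpen hJ₀).isCompact
  have hrank : (2 : ℕ∞) ≤ freeProlRank (J₀.map H.subtype : Subgroup E.arith) l := by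
    rw [← freeProlRank_eq_of_continuousMulEquiv e l, ← deltaInv_one_eq_freeProlRank l]
    exact hJ₀2
  -- LCFT: `δ¹_l(G_J) = 1`
  have hG1 : freeProlRank ((J₀.map H.subtype : Subgroup E.arith).map E.aug.toMonoidHom) l = 1 :=
    (freeProlRank_map_aug_of_rank thm26_ii_delta_gal_holds E B _ hJo).1 l hlp
  -- `l ∈ Σ`: off `Σ` there is no excess
  have hlS : l ∈ S := by
    by_contra hlS
    have h := E.freeProlRank_eq_map_aug_of_not_mem hΔS _ hJo hlS
    rw [h, hG1] at hrank
    exact absurd hrank (by norm_num)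
  exact ⟨J₀.map H.subtype, hJo, fun x hx => hmemH ⟨x, hx⟩, l, ⟨hlP⟩, hlS, hlp, hrank, hG1⟩

end FundamentalExtension

end Literature.AnabelianGeometry.AbsoluteAnabelian

end
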